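import Literature.RepresentationTheory.FiniteGroups.CharacterSpanHomConjClasses
import Literature.RepresentationTheory.FiniteGroups.GroupAlgebraCenterHomCharacterBijection
import Literature.RepresentationTheory.FiniteGroups.RationalGroupAlgebraCenterCharacterFields
import Mathlib.GroupTheory.Perm.Cycle.Type
import HarnessLib

/-!
# `Cent. ℝ[G] ≅ ℝ ⊗ R(G)` as `ℝ`-algebras (Serre, *Linear Representations of Finite Groups*, Ex. 13.10)

Topic `Literature/RepresentationTheory/FiniteGroups`, namespace `Literature.RepresentationTheory.FiniteGroups`
(lane `lit-hodgefound`, prover p38, generation 35, row g35-#7).  Sequel of `GroupAlgebraCenterHomCharacterBijection`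
(g35-#4: `centralAlgHom`, `ω_χ ∘ ι`), `CharacterSpanHomConjClasses` (g35-#5: `charSpan ℝ G = ℝ ⊗ R(G)`) and
`RealCharacters` (`natCard_real_irrChars_eq_natCard_real_conjClasses`: as many real irreducible characters as real
classes).  Three definitions with bodies (`conjTwistedPi`, `conjTwistedPiCongr`, `invConjClass`); everything else
proved; no named fact, no instance.

Source, verbatim (held `book:serre1977-linear-representations-finite-groups`, p0096, §13.2 exercises):

> "13.10. Show that the `R`-algebras `(Cent. R[G])` and `R ⊗ R(G)` are isomorphic."

(Compare Ex. 13.6 (b)–(c): over `Q` the analogous statement can fail — Thompson's example; over `R` it holds because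
`Γ_R = {1, c}` and two finite sets with involution are isomorphic as soon as they have the same numbers of points
and of fixed points, which here is "`h` real irreducible characters ⟺ `h` real classes".)

## The argument

Write `F(I, τ) ⊆ ℂ^I` for the `ℝ`-subalgebra `{w | w(τ i) = \overline{w(i)}}` attached to a set `I` with an
involution `τ` (`conjTwistedPi`).  (1) `z ↦ (ω_χ(ι z))_χ` is an `ℝ`-algebra isomorphism
`Cent. ℝ[G] ≅ F(Irr(G), χ ↦ χ̄)` (**`centerRealEquivConjTwistedPi`**): injective because the `ω_χ` detect
`Z(ℂ[G]) = ⊕ ℂ e_χ`, surjective because `Σ_χ w_χ e_χ` has real coefficients exactly when `w_{χ̄} = \overline{w_χ}`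
(`\overline{e_χ} = e_{χ̄}` coefficientwise).  (2) `f ↦ (f(x_c))_c` is an `ℝ`-algebra isomorphism
`ℝ ⊗ R(G) ≅ F(Cl(G), c ↦ c⁻¹)` (**`charSpanRealEquivConjTwistedPi`**): a class function is an `ℝ`-combination of
irreducible characters iff `f(x⁻¹) = \overline{f(x)}` (its coefficients `⟨f, χ⟩` are then real).  (3) Two finite
sets with involution having equally many points and equally many fixed points are isomorphic
(`exists_equiv_semiconj_of_involutive`, via Mathlib's `Equiv.Perm.isConj_iff_cycleType_eq`: an involution has cycle
type `(2, …, 2)`), and isomorphic involution-sets have isomorphic `F` (`conjTwistedPiCongr`).  (4) The numbers match: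
`|Irr(G)| = |Cl(G)| = h` and `#{χ = χ̄} = #{c = c⁻¹}` (`RealCharacters`).  Hence
**`nonempty_algEquiv_center_real_charSpan : Nonempty (Cent. ℝ[G] ≃ₐ[ℝ] ℝ ⊗ R(G))`**.

## Mathlib / tree search

`lean search --decl 'center ℝ|Cent.*ℝ\\[G\\]|charSpan ℝ|MonoidAlgebra ℝ G.*≃ₐ'` → the tree has the three types
(`RealIrreducibleThreeTypes`, `RealGroupAlgebraSimpleComponents`: `ℝ[G] ≅ Π M_{d_i}(D_i)`), the count of real
classes/characters (`RealCharacters`, `NumberOfRealIrreducibles`), but no statement comparing `Cent. ℝ[G]` with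
`ℝ ⊗ R(G)`.  Reused: `centralAlgHom`, `centralChar_mapRingHom_ringHom_comp` (g35-#4), `charSpan`, `evalCharSpan`,
`isClassFun_of_mem_charSpan` (g35-#5), `charIdempotent`, `coeff_charIdempotent`, `centralChar_charIdempotent`,
`eq_sum_centralChar_smul_charIdempotent`, `IsIrrChar.charIdempotent_mem_center` (g21-#1), `centralChar_sum`
(`RationalGroupAlgebraCenterCharacterFields`), `sum_smul_of_mem_center`,
`coeff_conj_eq_of_mem_center` (`GroupAlgebraCenter`), `IsIrrChar.star`, `IsCharacter.apply_inv_eq_conj`,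
`natCard_real_irrChars_eq_natCard_real_conjClasses` (`RealCharacters`), `IsClassFun.eq_sum_classInner_smul`,
`ncard_irrChars_eq_card_conjClasses`; Mathlib `Equiv.Perm.isConj_iff_cycleType_eq`, `pow_prime_eq_one_iff`,
`sum_cycleType`, `Function.Involutive.toPerm`, `AlgHom.pi`, `AlgEquiv.ofBijective`.

## References

* [SerreLinearRepresentations1977] J.-P. Serre, *Linear Representations of Finite Groups*, GTM 42, Springer 1977,
  §13.2 Ex. 13.10 (p0096); Ex. 13.6 (p0092).
-/

noncomputable section

open Module
open scoped BigOperators ComplexConjugate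

namespace Literature.RepresentationTheory.FiniteGroups

open scoped MonoidAlgebra

/-! ## §1 The `ℝ`-algebra `F(I, τ) = {w ∈ ℂ^I | w ∘ τ = conj ∘ w}` of a set with involution -/

section Twisted

variable (I : Type) (τ : I → I)

/-- **`F(I, τ) ⊆ ℂ^I`**: the `ℝ`-subalgebra of functions `w : I → ℂ` with `w(τ i) = \overline{w(i)}` — the real form
of `ℂ^I` defined by the involution `τ` (isomorphic to `ℝ^{#Fix τ} × ℂ^{#free orbits}`). [folklore; set-up for
SerreLinearRepresentations1977, Ex. 13.10] [cite: SerreLinearRepresentations1977, Ex. 13.10 (p0096)] -/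
def conjTwistedPi : Subalgebra ℝ (I → ℂ) where
  carrier := {w | ∀ i, w (τ i) = conj (w i)}
  mul_mem' {v w} hv hw := fun i => by rw [Pi.mul_apply, Pi.mul_apply, hv i, hw i, map_mul]
  one_mem' := fun i => by rw [Pi.one_apply, Pi.one_apply, map_one]
  add_mem' {v w} hv hw := fun i => by rw [Pi.add_apply, Pi.add_apply, hv i, hw i, map_add]
  zero_mem' := fun i => by rw [Pi.zero_apply, Pi.zero_apply, map_zero]
  algebraMap_mem' r := fun i => by simp only [Pi.algebraMap_apply, Complex.coe_algebraMap, Complex.conj_ofReal]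

variable {I τ}

/-- Membership in `F(I, τ)`. [cite: SerreLinearRepresentations1977, Ex. 13.10 (p0096)] -/
theorem mem_conjTwistedPi_iff {w : I → ℂ} : w ∈ conjTwistedPi I τ ↔ ∀ i, w (τ i) = conj (w i) :=
  Iff.rfl

/-- **Isomorphic sets-with-involution have isomorphic real forms**: an equivariant bijection `e : I ≃ I'`
(`e ∘ τ = τ' ∘ e`) induces `F(I, τ) ≃ₐ[ℝ] F(I', τ')`, `w ↦ w ∘ e⁻¹`. [cite: SerreLinearRepresentations1977, Ex. 13.10 (p0096)] -/
def conjTwistedPiCongr {I I' : Type} {τ : I → I} {τ' : I' → I'} (e : I ≃ I') (he : ∀ i, e (τ i) = τ' (e i)) :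
    conjTwistedPi I τ ≃ₐ[ℝ] conjTwistedPi I' τ' where
  toFun w := ⟨fun i' => (w : I → ℂ) (e.symm i'), fun i' => by
    have h : e.symm (τ' i') = τ (e.symm i') := by
      apply e.injective
      rw [Equiv.apply_symm_apply, he, Equiv.apply_symm_apply]
    show (w : I → ℂ) (e.symm (τ' i')) = conj ((w : I → ℂ) (e.symm i'))
    rw [h, w.2]⟩
  invFun v := ⟨fun i => (v : I' → ℂ) (e i), fun i => by
    show (v : I' → ℂ) (e (τ i)) = conj ((v : I' → ℂ) (e i))
    rw [he]
    exact v.2 (e i)⟩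
  left_inv w := Subtype.ext (funext fun i => by simp)
  right_inv v := Subtype.ext (funext fun i' => by simp)
  map_mul' v w := Subtype.ext (funext fun i' => rfl)
  map_add' v w := Subtype.ext (funext fun i' => rfl)
  commutes' r := Subtype.ext (funext fun i' => by
    simp only [Subalgebra.coe_algebraMap, Pi.algebraMap_apply])

/-- Fixed points of an involution and the support of the associated permutation are complementary. [folklore] -/
private theorem natCard_fixed_add_card_support {I : Type} [Fintype I] [DecidableEq I] {τ : I → I}
    (hτ : Function.Involutive τ) :
    Nat.card {i // τ i = i} + (hτ.toPerm τ).support.card = Fintype.card I := by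
  classical
  have hs : (hτ.toPerm τ).support = Finset.univ.filter fun i => ¬τ i = i := by
    ext i
    simp [Equiv.Perm.mem_support]
  rw [Nat.card_eq_fintype_card, Fintype.card_subtype, hs, Finset.card_filter_add_card_filter_not, Finset.card_univ]

/-- The cycle type of an involution is `(2, 2, …, 2)` with `|support|/2` entries. [folklore] -/
private theorem cycleType_of_involutive {I : Type} [Fintype I] [DecidableEq I] {τ : I → I}
    (hτ : Function.Involutive τ) :
    (hτ.toPerm τ).cycleType = Multiset.replicate (Multiset.card (hτ.toPerm τ).cycleType) 2 := by
  haveI : Fact (Nat.Prime 2) := ⟨Nat.prime_two⟩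
  rw [Multiset.eq_replicate_card]
  apply Equiv.Perm.pow_prime_eq_one_iff.mp
  ext i
  simp [pow_two, hτ i]

/-- **Two finite sets with involution are isomorphic iff they have as many points and as many fixed points** (the
direction needed here): an equivariant bijection exists.  Proof via Mathlib: involutions have cycle type
`(2, …, 2)`, so two of them with supports of the same size are conjugate (`Equiv.Perm.isConj_iff_cycleType_eq`).
[cite: SerreLinearRepresentations1977, Ex. 13.5–13.6 (p0091–p0092)] -/
theorem exists_equiv_semiconj_of_involutive {I I' : Type} [Finite I] [Finite I'] {τ : I → I} {τ' : I' → I'}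
    (hτ : Function.Involutive τ) (hτ' : Function.Involutive τ') (hcard : Nat.card I = Nat.card I')
    (hfix : Nat.card {i // τ i = i} = Nat.card {i' // τ' i' = i'}) :
    ∃ e : I ≃ I', ∀ i, e (τ i) = τ' (e i) := by
  classical
  haveI := Fintype.ofFinite I
  haveI := Fintype.ofFinite I'
  -- transport `τ'` to `I` along some bijection `f`
  obtain ⟨f⟩ : Nonempty (I ≃ I') := Finite.card_eq.mp hcard
  let τ'' : I → I := fun i => f.symm (τ' (f i))
  have hτ'' : Function.Involutive τ'' := fun i => by simp [τ'', hτ' (f i)]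
  have hfix'' : Nat.card {i // τ'' i = i} = Nat.card {i' // τ' i' = i'} :=
    Nat.card_congr (f.subtypeEquiv fun i => by
      constructor
      · intro h
        have := congrArg f h
        simpa [τ''] using this
      · intro h
        simp [τ'', h])
  -- the two involutions of `I` have the same cycle type, hence are conjugate
  have hsupp : (hτ.toPerm τ).support.card = (hτ''.toPerm τ'').support.card := by
    have h1 := natCard_fixed_add_card_support hτ
    have h2 := natCard_fixed_add_card_support hτ''
    omega
  have hct : (hτ.toPerm τ).cycleType = (hτ''.toPerm τ'').cycleType := by
    have c1 := cycleType_of_involutive hτ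
    have c2 := cycleType_of_involutive hτ''
    have s1 := Equiv.Perm.sum_cycleType (hτ.toPerm τ)
    have s2 := Equiv.Perm.sum_cycleType (hτ''.toPerm τ'')
    rw [c1, Multiset.sum_replicate, smul_eq_mul] at s1
    rw [c2, Multiset.sum_replicate, smul_eq_mul] at s2
    have hk : Multiset.card (hτ.toPerm τ).cycleType = Multiset.card (hτ''.toPerm τ'').cycleType := by omega
    rw [c1, c2, hk]
  obtain ⟨c, hc⟩ := isConj_iff.mp (Equiv.Perm.isConj_iff_cycleType_eq.mpr hct)
  refine ⟨c.trans f, fun i => ?_⟩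
  -- `c τ c⁻¹ = τ''` gives `c (τ i) = τ'' (c i)`, i.e. `f (c (τ i)) = τ' (f (c i))`
  have hci : c (τ i) = τ'' (c i) := by
    have := Equiv.congr_fun hc (c i)
    simpa [Equiv.Perm.mul_apply, Function.Involutive.coe_toPerm] using this
  simp [Equiv.trans_apply, hci, τ'']

end Twisted

/-! ## §2 `Cent. ℝ[G] ≅ F(Irr(G), χ ↦ χ̄)` -/

section Center

variable (G : Type) [Group G] [Fintype G]

/-- Complex conjugation `χ ↦ χ̄` as an involution of `Irr(G)`. [cite: SerreLinearRepresentations1977, §13.2 (p0094)] -/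
def starIrr : irrChars G → irrChars G := fun χ => ⟨star (χ : G → ℂ), IsIrrChar.star χ.2⟩

/-- `χ ↦ χ̄` is an involution. [cite: SerreLinearRepresentations1977, §13.2 (p0094)] -/
theorem starIrr_involutive : Function.Involutive (starIrr G) := fun χ => Subtype.ext (star_star (χ : G → ℂ))

variable {G}

/-- `\overline{e_χ} = e_{χ̄}` coefficientwise. [cite: Isaacs1976, Thm. 2.12 (p0024)] -/
private theorem conj_coeff_charIdempotent (χ : G → ℂ) (g : G) :
    conj ((charIdempotent χ).coeff g) = (charIdempotent (star χ)).coeff g := by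
  rw [coeff_charIdempotent, coeff_charIdempotent, map_mul, map_div₀, Complex.conj_natCast]
  rfl

/-- The coefficient of `g₀` in `Σ_g a(g) g`. [folklore] -/
private theorem coeff_sum_smul_of {k : Type} [CommRing k] (a : G → k) (g₀ : G) :
    (∑ g : G, a g • MonoidAlgebra.of k G g).coeff g₀ = a g₀ := by
  classical
  rw [MonoidAlgebra.coeff_sum, Finsupp.finsetSum_apply]
  simp_rw [MonoidAlgebra.coeff_smul_apply, MonoidAlgebra.of_apply, MonoidAlgebra.coeff_single, Finsupp.single_apply,
    smul_eq_mul, mul_ite, mul_one, mul_zero]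
  rw [Finset.sum_ite_eq' Finset.univ g₀, if_pos (Finset.mem_univ g₀)]

omit [Fintype G] in
/-- Coefficient extension `ℝ[G] → ℂ[G]` is injective. [folklore] -/
private theorem mapRingHom_real_injective :
    Function.Injective (MonoidAlgebra.mapRingHom G (algebraMap ℝ ℂ)) := fun x y h =>
  MonoidAlgebra.ext (Finsupp.ext fun g => (algebraMap ℝ ℂ).injective (by
    have := congrArg (fun z => MonoidAlgebra.coeff z g) h
    simpa only [MonoidAlgebra.coeff_mapRingHom] using this))

variable (G) in
/-- **`z ↦ (ω_χ(ι z))_{χ ∈ Irr(G)}` maps `Cent. ℝ[G]` into `F(Irr(G), χ ↦ χ̄)`**: `ω_{χ̄}(ι z) = \overline{ω_χ(ι z)}`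
for real `z`. [cite: SerreLinearRepresentations1977, Ex. 13.10 (p0096)] -/
def centerRealToConjTwistedPi :
    Subalgebra.center ℝ (MonoidAlgebra ℝ G) →ₐ[ℝ] conjTwistedPi (irrChars G) (starIrr G) :=
  (AlgHom.pi fun χ : irrChars G => centralAlgHom (K := ℝ) (χ.2 : IsIrrChar G χ)).codRestrict
    (conjTwistedPi (irrChars G) (starIrr G)) fun z χ => by
      rw [AlgHom.pi_apply, AlgHom.pi_apply, centralAlgHom_apply, centralAlgHom_apply]
      have h := centralChar_mapRingHom_ringHom_comp ℝ (starRingEnd ℂ) (fun r => Complex.conj_ofReal r) (χ : G → ℂ)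
        (z : MonoidAlgebra ℝ G)
      exact h

/-- Unfolding lemma. [cite: SerreLinearRepresentations1977, Ex. 13.10 (p0096)] -/
theorem centerRealToConjTwistedPi_apply (z : Subalgebra.center ℝ (MonoidAlgebra ℝ G)) (χ : irrChars G) :
    (centerRealToConjTwistedPi G z : irrChars G → ℂ) χ = centralAlgHom (K := ℝ) (χ.2 : IsIrrChar G χ) z :=
  rfl

/-- **Injectivity**: the central characters separate `Z(ℂ[G]) = ⊕_χ ℂ e_χ`, and `ι : ℝ[G] → ℂ[G]` is injective.
[cite: SerreLinearRepresentations1977, §6.3 Prop. 13 (p0045), Ex. 13.10 (p0096)] -/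
theorem centerRealToConjTwistedPi_injective : Function.Injective (centerRealToConjTwistedPi G) := by
  rw [injective_iff_map_eq_zero]
  intro z hz
  have hzero : ∀ χ : G → ℂ, IsIrrChar G χ →
      centralChar χ (MonoidAlgebra.mapRingHom G (algebraMap ℝ ℂ) (z : MonoidAlgebra ℝ G)) = 0 := fun χ hχ => by
    have := congrArg (fun w : conjTwistedPi (irrChars G) (starIrr G) => (w : irrChars G → ℂ) ⟨χ, hχ⟩) hz
    simpa [centerRealToConjTwistedPi_apply, centralAlgHom_apply] using this
  have hι : MonoidAlgebra.mapRingHom G (algebraMap ℝ ℂ) (z : MonoidAlgebra ℝ G) = 0 := by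
    rw [eq_sum_centralChar_smul_charIdempotent (mapRingHom_mem_center ℝ z.2)]
    exact Finset.sum_eq_zero fun χ hχ => by
      rw [hzero χ ((irrChars_finite_holds G).mem_toFinset.mp hχ), zero_smul]
  exact Subtype.ext (mapRingHom_real_injective (by rw [hι, ZeroMemClass.coe_zero, map_zero]))

/-- **Surjectivity**: for `w ∈ F(Irr(G), ¯)` the central element `Σ_χ w_χ e_χ ∈ Z(ℂ[G])` has real coefficients
(`\overline{e_χ} = e_{χ̄}`, `\overline{w_χ} = w_{χ̄}`), so it is `ι z` with `z ∈ Cent. ℝ[G]`, and `ω_χ(ι z) = w_χ`.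
[cite: SerreLinearRepresentations1977, Ex. 13.10 (p0096)] -/
theorem centerRealToConjTwistedPi_surjective : Function.Surjective (centerRealToConjTwistedPi G) := by
  classical
  intro w
  set F := (irrChars_finite_holds G).toFinset with hF
  have hmemF : ∀ {χ : G → ℂ}, χ ∈ F ↔ IsIrrChar G χ := fun {χ} => (irrChars_finite_holds G).mem_toFinset
  -- `w` extended by `0` outside `Irr(G)`
  let w' : (G → ℂ) → ℂ := fun χ => if h : IsIrrChar G χ then (w : irrChars G → ℂ) ⟨χ, h⟩ else 0
  have hw' : ∀ {χ} (h : IsIrrChar G χ), w' χ = (w : irrChars G → ℂ) ⟨χ, h⟩ := fun h => dif_pos h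
  have hw'star : ∀ {χ}, IsIrrChar G χ → w' (star χ) = conj (w' χ) := by
    intro χ hχ
    rw [hw' hχ, hw' hχ.star]
    exact w.2 ⟨χ, hχ⟩
  -- the complex central element `Z = Σ w_χ e_χ` and its coefficients
  let Z : MonoidAlgebra ℂ G := ∑ χ ∈ F, w' χ • charIdempotent χ
  have hZcoeff : ∀ g, Z.coeff g = ∑ χ ∈ F, w' χ * (charIdempotent χ).coeff g := fun g => by
    simp only [Z, MonoidAlgebra.coeff_sum, Finsupp.finsetSum_apply, MonoidAlgebra.coeff_smul_apply, smul_eq_mul]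
  have hZreal : ∀ g, conj (Z.coeff g) = Z.coeff g := by
    intro g
    rw [hZcoeff, map_sum]
    -- reindex the sum along `χ ↦ χ̄`
    refine Finset.sum_bij' (fun χ _ => star χ) (fun χ _ => star χ) (fun χ hχ => hmemF.mpr (hmemF.mp hχ).star)
      (fun χ hχ => hmemF.mpr (hmemF.mp hχ).star) (fun χ _ => star_star χ) (fun χ _ => star_star χ) ?_
    intro χ hχ
    rw [map_mul, conj_coeff_charIdempotent, hw'star (hmemF.mp hχ)]
  have hZcen : Z ∈ Subalgebra.center ℂ (MonoidAlgebra ℂ G) :=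
    Subalgebra.sum_mem _ fun χ hχ => Subalgebra.smul_mem _ (hmemF.mp hχ).charIdempotent_mem_center _
  -- the real element `z` with `ι z = Z`
  let z : MonoidAlgebra ℝ G := ∑ g : G, (Z.coeff g).re • MonoidAlgebra.of ℝ G g
  have hιz : MonoidAlgebra.mapRingHom G (algebraMap ℝ ℂ) z = Z := by
    refine MonoidAlgebra.ext (Finsupp.ext fun g => ?_)
    rw [MonoidAlgebra.coeff_mapRingHom, coeff_sum_smul_of, Complex.coe_algebraMap]
    exact Complex.conj_eq_iff_re.mp (hZreal g) ▸ rfl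
  have hzcen : z ∈ Subalgebra.center ℝ (MonoidAlgebra ℝ G) := by
    refine sum_smul_of_mem_center fun g h => ?_
    rw [coeff_conj_eq_of_mem_center hZcen]
  refine ⟨⟨z, hzcen⟩, Subtype.ext (funext fun χ => ?_)⟩
  rw [centerRealToConjTwistedPi_apply, centralAlgHom_apply, Subtype.coe_mk, hιz, centralChar_sum,
    Finset.sum_eq_single_of_mem (χ : G → ℂ) (hmemF.mpr χ.2)]
  · rw [centralChar_smul, centralChar_charIdempotent χ.2 χ.2, if_pos rfl, mul_one, hw' χ.2]
  · intro ψ hψ hne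
    rw [centralChar_smul, centralChar_charIdempotent χ.2 (hmemF.mp hψ), if_neg (Ne.symm hne), mul_zero]

variable (G) in
/-- **`Cent. ℝ[G] ≅ F(Irr(G), χ ↦ χ̄)`** as `ℝ`-algebras, via `z ↦ (ω_χ(ι z))_χ`.
[cite: SerreLinearRepresentations1977, Ex. 13.10 (p0096), §6.3 Prop. 13 (p0045)] -/
def centerRealEquivConjTwistedPi :
    Subalgebra.center ℝ (MonoidAlgebra ℝ G) ≃ₐ[ℝ] conjTwistedPi (irrChars G) (starIrr G) :=
  AlgEquiv.ofBijective (centerRealToConjTwistedPi G)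
    ⟨centerRealToConjTwistedPi_injective, centerRealToConjTwistedPi_surjective⟩

end Center

/-! ## §3 `ℝ ⊗ R(G) ≅ F(Cl(G), c ↦ c⁻¹)` -/

section CharSpan

variable (G : Type) [Group G] [Fintype G]

/-- A representative of a conjugacy class. [folklore] -/
private def rep (c : ConjClasses G) : G := Classical.choose (ConjClasses.exists_rep c)

omit [Fintype G] in
/-- `rep c` represents `c`. [folklore] -/
private theorem mk_rep (c : ConjClasses G) : ConjClasses.mk (rep G c) = c :=
  Classical.choose_spec (ConjClasses.exists_rep c)

omit [Fintype G] in
/-- The chosen representative of the class of `g` is conjugate to `g`. [folklore] -/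
private theorem isConj_rep_mk (g : G) : IsConj (rep G (ConjClasses.mk g)) g :=
  ConjClasses.mk_eq_mk_iff_isConj.mp (mk_rep G (ConjClasses.mk g))

/-- **The inverse class `c⁻¹ = {x⁻¹ : x ∈ c}`** (Serre Ex. 13.9: "`c` is *even* if `c = c⁻¹`"), as an involution of
`Cl(G)`. [cite: SerreLinearRepresentations1977, Ex. 13.9 (p0096)] -/
def invConjClass (c : ConjClasses G) : ConjClasses G := ConjClasses.mk (rep G c)⁻¹

variable {G}

omit [Fintype G] in
/-- `(Cl x)⁻¹ = Cl(x⁻¹)`. [cite: SerreLinearRepresentations1977, Ex. 13.9 (p0096)] -/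
theorem invConjClass_mk (g : G) : invConjClass G (ConjClasses.mk g) = ConjClasses.mk g⁻¹ := by
  rw [invConjClass, ConjClasses.mk_eq_mk_iff_isConj, isConj_iff]
  obtain ⟨t, ht⟩ := isConj_iff.mp (isConj_rep_mk G g)
  exact ⟨t, by rw [← conj_inv, ht]⟩

variable (G) in
omit [Fintype G] in
/-- `c ↦ c⁻¹` is an involution. [cite: SerreLinearRepresentations1977, Ex. 13.9 (p0096)] -/
theorem invConjClass_involutive : Function.Involutive (invConjClass G) := fun c => by
  obtain ⟨g, rfl⟩ := ConjClasses.exists_rep c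
  rw [invConjClass_mk, invConjClass_mk, inv_inv]

omit [Fintype G] in
/-- `c⁻¹ = c` iff the class is real (`x ~ x⁻¹`). [cite: SerreLinearRepresentations1977, Ex. 13.9 (p0096)] -/
theorem invConjClass_eq_self_iff (c : ConjClasses G) :
    invConjClass G c = c ↔ ∃ g : G, ConjClasses.mk g = c ∧ IsConj g g⁻¹ := by
  obtain ⟨g, rfl⟩ := ConjClasses.exists_rep c
  rw [invConjClass_mk, ConjClasses.mk_eq_mk_iff_isConj]
  constructor
  · exact fun h => ⟨g, rfl, h.symm⟩
  · rintro ⟨g', hg', h'⟩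
    have hgg' : IsConj g' g := ConjClasses.mk_eq_mk_iff_isConj.mp hg'
    -- `g⁻¹ ~ g'⁻¹ ~ g' ~ g`
    obtain ⟨t, ht⟩ := isConj_iff.mp hgg'
    have hinv : IsConj g'⁻¹ g⁻¹ := isConj_iff.mpr ⟨t, by rw [← ht, conj_inv]⟩
    exact (hinv.symm.trans h'.symm).trans hgg'

/-- Elements of `ℝ ⊗ R(G)` satisfy `f(x⁻¹) = \overline{f(x)}` (true for characters, `ℝ`-linear in `f`).
[cite: SerreLinearRepresentations1977, §13.2 (p0094)] -/
theorem apply_inv_eq_conj_of_mem_charSpan {f : G → ℂ} (hf : f ∈ charSpan ℝ G) (x : G) : f x⁻¹ = conj (f x) := by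
  induction hf using Submodule.span_induction with
  | mem χ hχ => exact (IsIrrChar.isCharacter hχ).apply_inv_eq_conj x
  | zero => simp
  | add f f' _ _ hf hf' => rw [Pi.add_apply, Pi.add_apply, map_add, hf, hf']
  | smul r f _ hf => rw [Pi.smul_apply, Pi.smul_apply, Complex.real_smul, Complex.real_smul, map_mul,
      Complex.conj_ofReal, hf]

variable (G) in
/-- **`f ↦ (f(x_c))_{c ∈ Cl(G)}` maps `ℝ ⊗ R(G)` into `F(Cl(G), c ↦ c⁻¹)`.**
[cite: SerreLinearRepresentations1977, Ex. 13.10 (p0096)] -/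
def charSpanRealToConjTwistedPi : charSpan ℝ G →ₐ[ℝ] conjTwistedPi (ConjClasses G) (invConjClass G) :=
  (AlgHom.pi fun c : ConjClasses G => evalCharSpan ℝ G (rep G c)).codRestrict
    (conjTwistedPi (ConjClasses G) (invConjClass G)) fun f c => by
      rw [AlgHom.pi_apply, AlgHom.pi_apply, evalCharSpan_apply, evalCharSpan_apply,
        ← apply_inv_eq_conj_of_mem_charSpan f.2]
      -- `rep (c⁻¹) ~ (rep c)⁻¹`
      have h : IsConj (rep G (invConjClass G c)) (rep G c)⁻¹ := by
        rw [← ConjClasses.mk_eq_mk_iff_isConj, mk_rep, invConjClass]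
      obtain ⟨t, ht⟩ := isConj_iff.mp h
      rw [← isClassFun_of_mem_charSpan f.2 (rep G (invConjClass G c)) t, ht]

/-- Unfolding lemma. [cite: SerreLinearRepresentations1977, Ex. 13.10 (p0096)] -/
theorem charSpanRealToConjTwistedPi_apply_mk (f : charSpan ℝ G) (g : G) :
    (charSpanRealToConjTwistedPi G f : ConjClasses G → ℂ) (ConjClasses.mk g) = (f : G → ℂ) g := by
  change (f : G → ℂ) (rep G (ConjClasses.mk g)) = (f : G → ℂ) g
  obtain ⟨t, ht⟩ := isConj_iff.mp (isConj_rep_mk G g)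
  rw [← isClassFun_of_mem_charSpan f.2 (rep G (ConjClasses.mk g)) t, ht]

/-- **Injectivity** (a class function is determined by its values on class representatives).
[cite: SerreLinearRepresentations1977, Ex. 13.10 (p0096)] -/
theorem charSpanRealToConjTwistedPi_injective : Function.Injective (charSpanRealToConjTwistedPi G) := by
  intro f f' h
  refine Subtype.ext (funext fun g => ?_)
  rw [← charSpanRealToConjTwistedPi_apply_mk f g, ← charSpanRealToConjTwistedPi_apply_mk f' g, h]

/-- **Surjectivity**: a class function `f` with `f(x⁻¹) = \overline{f(x)}` has real coordinates `⟨f, χ⟩` in the basis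
`Irr(G)`, hence lies in `ℝ ⊗ R(G)`. [cite: SerreLinearRepresentations1977, Ex. 13.10 (p0096), §13.2 (p0094)] -/
theorem charSpanRealToConjTwistedPi_surjective : Function.Surjective (charSpanRealToConjTwistedPi G) := by
  classical
  intro v
  let f : G → ℂ := fun g => (v : ConjClasses G → ℂ) (ConjClasses.mk g)
  have hfcl : IsClassFun f := fun s t =>
    congrArg (v : ConjClasses G → ℂ)
      (ConjClasses.mk_eq_mk_iff_isConj.mpr (isConj_iff.mpr ⟨t, rfl⟩ : IsConj s (t * s * t⁻¹)).symm)
  have hfinv : ∀ g, f g⁻¹ = conj (f g) := fun g => by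
    simp only [f]
    rw [← invConjClass_mk, v.2]
  -- the coordinates `⟨f, χ⟩` are real
  have hreal : ∀ {χ : G → ℂ}, IsIrrChar G χ → conj (classInner f χ) = classInner f χ := by
    intro χ hχ
    rw [classInner_apply, map_mul, map_inv₀, Complex.conj_natCast, map_sum]
    congr 1
    -- `Σ conj(f s) conj(χ s⁻¹) = Σ f(s⁻¹) χ(s)`; reindex `s ↦ s⁻¹`
    rw [← Equiv.sum_comp (Equiv.inv G)]
    refine Finset.sum_congr rfl fun s _ => ?_
    simp only [Equiv.inv_apply, inv_inv, map_mul]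
    rw [← hfinv s⁻¹, inv_inv, ← (IsIrrChar.isCharacter hχ).apply_inv_eq_conj s]
  have hf : f ∈ charSpan ℝ G := by
    rw [mem_charSpan_iff, hfcl.eq_sum_classInner_smul]
    refine Submodule.sum_mem _ fun χ hχ => ?_
    have hχ' : IsIrrChar G χ := (irrChars_finite_holds G).mem_toFinset.mp hχ
    have hsm : classInner f χ • χ = (classInner f χ).re • χ := by
      funext g
      rw [Pi.smul_apply, Pi.smul_apply, smul_eq_mul, Complex.real_smul, Complex.conj_eq_iff_re.mp (hreal hχ')]
    rw [hsm]
    exact Submodule.smul_mem _ _ (Submodule.subset_span hχ')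
  refine ⟨⟨f, hf⟩, Subtype.ext (funext fun c => ?_)⟩
  obtain ⟨g, rfl⟩ := ConjClasses.exists_rep c
  rw [charSpanRealToConjTwistedPi_apply_mk]

variable (G) in
/-- **`ℝ ⊗ R(G) ≅ F(Cl(G), c ↦ c⁻¹)`** as `ℝ`-algebras, via evaluation at the classes.
[cite: SerreLinearRepresentations1977, Ex. 13.10 (p0096)] -/
def charSpanRealEquivConjTwistedPi : charSpan ℝ G ≃ₐ[ℝ] conjTwistedPi (ConjClasses G) (invConjClass G) :=
  AlgEquiv.ofBijective (charSpanRealToConjTwistedPi G)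
    ⟨charSpanRealToConjTwistedPi_injective, charSpanRealToConjTwistedPi_surjective⟩

end CharSpan

/-! ## §4 Ex. 13.10: `Cent. ℝ[G] ≅ ℝ ⊗ R(G)` -/

section Main

variable (G : Type) [Group G] [Fintype G]

/-- `|Irr(G)| = |Cl(G)|` as `Nat.card`s of types. [cite: SerreLinearRepresentations1977, §2.5 Thm. 7] -/
theorem natCard_irrChars_eq_natCard_conjClasses : Nat.card (irrChars G) = Nat.card (ConjClasses G) := by
  rw [Nat.card_coe_set_eq, ncard_irrChars_eq_card_conjClasses]

/-- **As many conjugation-fixed irreducible characters as inversion-fixed classes** (real characters vs real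
classes, `RealCharacters.natCard_real_irrChars_eq_natCard_real_conjClasses`, restated for the two involutions).
[cite: SerreLinearRepresentations1977, §13.2 (p0094)] -/
theorem natCard_fixed_starIrr_eq_natCard_fixed_invConjClass :
    Nat.card {χ : irrChars G // starIrr G χ = χ} = Nat.card {c : ConjClasses G // invConjClass G c = c} := by
  have h1 : Nat.card {χ : irrChars G // starIrr G χ = χ} = Nat.card {χ : G → ℂ // IsIrrChar G χ ∧ star χ = χ} :=
    Nat.card_congr
      { toFun := fun χ => ⟨χ.1.1, χ.1.2, congrArg Subtype.val χ.2⟩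
        invFun := fun χ => ⟨⟨χ.1, χ.2.1⟩, Subtype.ext χ.2.2⟩
        left_inv := fun χ => rfl
        right_inv := fun χ => rfl }
  have h2 : Nat.card {c : ConjClasses G // invConjClass G c = c} =
      Nat.card {c : ConjClasses G // ∃ g : G, ConjClasses.mk g = c ∧ IsConj g g⁻¹} :=
    Nat.card_congr (Equiv.subtypeEquivRight fun c => invConjClass_eq_self_iff c)
  rw [h1, h2, natCard_real_irrChars_eq_natCard_real_conjClasses]

/-- **Serre Ex. 13.10. "The `R`-algebras `(Cent. R[G])` and `R ⊗ R(G)` are isomorphic."**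
(`Cent. ℝ[G] ≅ F(Irr, ¯) ≅ F(Cl, ⁻¹) ≅ ℝ ⊗ R(G)`, the middle isomorphism coming from an equivariant bijection
`(Irr(G), χ ↦ χ̄) ≃ (Cl(G), c ↦ c⁻¹)`, which exists because both involutions have `h` points and equally many fixed
points.) [cite: SerreLinearRepresentations1977, Ex. 13.10 (p0096)] -/
theorem nonempty_algEquiv_center_real_charSpan :
    Nonempty (Subalgebra.center ℝ (MonoidAlgebra ℝ G) ≃ₐ[ℝ] charSpan ℝ G) := by
  haveI : Finite (irrChars G) := (irrChars_finite_holds G).to_subtype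
  obtain ⟨e, he⟩ := exists_equiv_semiconj_of_involutive (starIrr_involutive G) (invConjClass_involutive G)
    (natCard_irrChars_eq_natCard_conjClasses G) (natCard_fixed_starIrr_eq_natCard_fixed_invConjClass G)
  exact ⟨((centerRealEquivConjTwistedPi G).trans (conjTwistedPiCongr e he)).trans
    (charSpanRealEquivConjTwistedPi G).symm⟩

end Main

end Literature.RepresentationTheory.FiniteGroups

end
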